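import Mathlib
import Summits.ValiantsHypothesis.ValiantsHypothesis.Theorems.RigidityForcesSymmetryRankRigidMinimalReprLaplaceFiveSeparatedCaptureLinesK1
import Summits.ValiantsHypothesis.ValiantsHypothesis.Theorems.RigidityForcesSymmetryRankRigidMinimalReprLaplaceFiveSeparatedCaptureDisjointPair

/-!
# ValiantsHypothesis / RigidityForcesSymmetry — crux `LaplaceOptimalFive` (stmt-ValiantsHypothesis-24813), young-shadow K1:
# **K1 ON `K₃ ⊔ K₂` FOR A DISJOINT PAIR OF TRIANGLE SPANS** (total dimension `≤ 3`, third cut `≤ 2`)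

K1 consumer of ✓ `captureIneqSym_of_disjoint_pair` (val-port-2 g5: the symmetric capture inequality for a DISJOINT pair of triangle
spans `U ⊓ U′ = ⊥` with `dim U + dim U′ ≤ 3` and a third span of dimension `≤ 2`) through the local bridge ✓ `sideSym_K32canon_of_captureAt`
(`…K1Bridge.lean`), in the shape of ✓ `sideSym_K32canon_lines` / ✓ `sideSym_K32canon_two_lines`: a side-symmetric split decomposition of
`P₅` on `{01, 02, 12, 34}` two of whose triangle short spans are disjoint of total dimension `≤ 3`, the third of dimension `≤ 2`, has
Laplace weight `≥ 5! = 120` — in all three placements of the disjoint pair (rôle symmetry ✓ `contractZ_mem_L3_swap23/13`).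

* ★★ `sideSym_K32canon_disjoint_pair` — disjoint pair on the cuts `{0,1}, {0,2}`;  ★ `…_pair01_12`, ★ `…_pair02_12` — the other two.

Honest framing.  A SUB-CASE of K1 on `K₃ ⊔ K₂` (⊋ ✓ `sideSym_K32canon_lines` for two distinct lines); K1 on `K₃ ⊔ K₂` in general,
`CaptureIneqSym`, S2′, `LaplaceOptimalFive` (OPEN · CONTESTED 72/120), `RankRigidMinimalRepr`, `VP ≠ VNP` are NOT proved.  No definitions,
no `sorry`.
-/

set_option linter.dupNamespace false
set_option autoImplicit false

namespace Summit.ValiantsHypothesis.ValiantsHypothesis.Theorems.RigidityForcesSymmetryRankRigidMinimalRepr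

namespace LaplaceFiveSeparatedCapture

open Finset LaplaceFiveSectorSplit

/-- ★★ **K1 ON `K₃ ⊔ K₂ = {01, 02, 12, 34}` FOR DISJOINT SPANS ON `{0,1}`, `{0,2}`** (total dimension `≤ 3`; the span on `{1,2}` of
dimension `≤ 2`). [folklore] -/
theorem sideSym_K32canon_disjoint_pair {N : ℕ} (T : Finset (Fin N)) (S : Fin N → Finset (Fin 5))
    (u w : Fin N → (Fin 5 → Fin 5) → ℂ) (hdec : IsSplitDecomposition T S u w) (hsym : SideSymmetric T S u w)
    (hC : ∀ t ∈ T, S t = ({0, 1} : Finset (Fin 5)) ∨ S t = ({0, 2} : Finset (Fin 5)) ∨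
      S t = ({1, 2} : Finset (Fin 5)) ∨ S t = ({3, 4} : Finset (Fin 5)))
    (hdis : shortSpan T S u 0 1 ⊓ shortSpan T S u 0 2 = ⊥)
    (h3 : Module.finrank ℂ (shortSpan T S u 0 1) + Module.finrank ℂ (shortSpan T S u 0 2) ≤ 3)
    (h12 : Module.finrank ℂ (shortSpan T S u 1 2) ≤ 2) :
    Nat.factorial 5 ≤ laplaceWeight T S :=
  sideSym_K32canon_of_captureAt T S u w hdec hsym hC fun hs01 hs02 hs12 W hWs hWd hWc =>
    captureIneqSym_of_disjoint_pair _ _ _ W hs01 hs02 hs12 hdis h3 h12 hWs hWd hWc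

/-- ★ **Disjoint pair on the cuts `{0,1}`, `{1,2}`** (the span on `{0,2}` of dimension `≤ 2`), by the rôle symmetry
✓ `contractZ_mem_L3_swap23`. [folklore] -/
theorem sideSym_K32canon_disjoint_pair01_12 {N : ℕ} (T : Finset (Fin N)) (S : Fin N → Finset (Fin 5))
    (u w : Fin N → (Fin 5 → Fin 5) → ℂ) (hdec : IsSplitDecomposition T S u w) (hsym : SideSymmetric T S u w)
    (hC : ∀ t ∈ T, S t = ({0, 1} : Finset (Fin 5)) ∨ S t = ({0, 2} : Finset (Fin 5)) ∨
      S t = ({1, 2} : Finset (Fin 5)) ∨ S t = ({3, 4} : Finset (Fin 5)))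
    (hdis : shortSpan T S u 0 1 ⊓ shortSpan T S u 1 2 = ⊥)
    (h3 : Module.finrank ℂ (shortSpan T S u 0 1) + Module.finrank ℂ (shortSpan T S u 1 2) ≤ 3)
    (h02 : Module.finrank ℂ (shortSpan T S u 0 2) ≤ 2) :
    Nat.factorial 5 ≤ laplaceWeight T S := by
  refine sideSym_K32canon_of_captureAt T S u w hdec hsym hC fun hs01 hs02 hs12 W hWs hWd hWc => ?_
  have hWc' : ∀ μ ∈ W, contractZ μ ∈ L3 (shortSpan T S u 0 1) (shortSpan T S u 1 2) (shortSpan T S u 0 2) :=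
    fun μ hμ => contractZ_mem_L3_swap23 _ _ _ hs01 μ (hWc μ hμ)
  have h := captureIneqSym_of_disjoint_pair _ _ _ W hs01 hs12 hs02 hdis h3 h02 hWs hWd hWc'
  omega

/-- ★ **Disjoint pair on the cuts `{1,2}`, `{0,2}`** (the span on `{0,1}` of dimension `≤ 2`), by the rôle symmetry
✓ `contractZ_mem_L3_swap13`. [folklore] -/
theorem sideSym_K32canon_disjoint_pair02_12 {N : ℕ} (T : Finset (Fin N)) (S : Fin N → Finset (Fin 5))
    (u w : Fin N → (Fin 5 → Fin 5) → ℂ) (hdec : IsSplitDecomposition T S u w) (hsym : SideSymmetric T S u w)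
    (hC : ∀ t ∈ T, S t = ({0, 1} : Finset (Fin 5)) ∨ S t = ({0, 2} : Finset (Fin 5)) ∨
      S t = ({1, 2} : Finset (Fin 5)) ∨ S t = ({3, 4} : Finset (Fin 5)))
    (hdis : shortSpan T S u 1 2 ⊓ shortSpan T S u 0 2 = ⊥)
    (h3 : Module.finrank ℂ (shortSpan T S u 1 2) + Module.finrank ℂ (shortSpan T S u 0 2) ≤ 3)
    (h01 : Module.finrank ℂ (shortSpan T S u 0 1) ≤ 2) :
    Nat.factorial 5 ≤ laplaceWeight T S := by
  refine sideSym_K32canon_of_captureAt T S u w hdec hsym hC fun hs01 hs02 hs12 W hWs hWd hWc => ?_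
  have hWc' : ∀ μ ∈ W, contractZ μ ∈ L3 (shortSpan T S u 1 2) (shortSpan T S u 0 2) (shortSpan T S u 0 1) :=
    fun μ hμ => contractZ_mem_L3_swap13 _ _ _ hs01 hs02 hs12 μ (hWc μ hμ)
  have h := captureIneqSym_of_disjoint_pair _ _ _ W hs12 hs02 hs01 hdis h3 h01 hWs hWd hWc'
  omega

end LaplaceFiveSeparatedCapture

end Summit.ValiantsHypothesis.ValiantsHypothesis.Theorems.RigidityForcesSymmetryRankRigidMinimalRepr
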